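import Summits.AtomisticToContinuum.Crystallization.Theorems.ChartedZeroExcessLayeredLatticeLiouvilleUH
/-!
# Zero-excess layered lattice Liouville — part UI (lens-2 g51 node «ChartLamella»): relatively faulted equilibrium charts refute the same-chart
# ε-regularity pieces as typed; the repair threads the tree's bond-isomorphism clause `IsBondIso` (part TG), which the column already PROVES and discards

(1) THE FINDING (argument grade, g51).  Every piece of the (R_W)-line of the shape «for EVERY equilibrium chart `(L, w)` and EVERY `(Cg, η, R)`-registration
`Ψ : S → LayeredHom L w` [+ `Ψ`-free side conditions] there is a re-registration `Ψ'` INTO THE SAME CHART whose defect mass is `o(η)·nK(win R)`, resp. obeys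
a reverse-Hölder / Caccioppoli inequality on balls» is FALSE as typed on the intended inhabitant: (A1) `WildReRegistrationPG`, (R_W) `WildFractionPG`,
(M) `StrainNonConcentrationPG`, [C] `RigidCaccioppoliPG`, [C_T] `TameRigidCaccioppoliPG`, [CC] `TameGscCaccioppoliPG`, [CC°] `TameGscCaccioppoliFloorPG`,
[CC°_W] `CoherentGscCaccioppoliPG`, and the sup-registration piece [SR] of critic row 830.  WITNESS «ChartLamella»: `S :=` the perfect hcp GSC door set;
`H := LayeredHom L w` with `L :=` the (exactly conformal) lattice map of `S` itself and `w :=` the stacking data of `S` with ONE central layer moved to the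
third registry (`A B A B C B A B`, Hägg word `… h h c h c h h …`: two c-letters flanking the C-layer) at relaxed heights — clean and single-site Nash, hence an
admissible `IsEquilChart` (the A0-line REQUIRES equilibrium charts for every Hägg word: (A0♭⁺ˣ); g33 layer-chain census `λ_min ≥ 16.9` on 29 words);
`Ψ :=` the identity off the C-layer and the registry translation (length `1/√3`) on it: a bijection `S → H`, two-sided tear-free `4 ↦ 8`, `IsRegistered` at
every scale `D ≥ R` with profile `τ = 6/5` on the 11 layers within distance 4 of the C-layer and `τ = 0` elsewhere, i.e. `IsGlobalReg Cg η R` as soon as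
`R·Cg·η ≥ 9.7`; the window is fat for large `R`; the binder order `∀ Cg ∃ Cg' ∀ ε ∃ η₁ R₁ ∀ η ≤ η₁ ∀ R ≥ R₁` admits `η → 0`, `R := max (R₁, 9.7/(Cg·η))`.
On the conclusion side EVERY bijection `Ψ' : S → H` has strain `σ x ≥ σ_hc` at the `Ψ'`-preimage `x` of each c-site of `H`: for `σ x < 1/5` the twelve
neighbours of `x` land injectively on the twelve contacts of `Ψ' x`, and h- and c-stars have NON-ISOMORPHIC contact graphs (cuboctahedron: every vertex
link = two disjoint edges; anticuboctahedron: equatorial links contain a path `P₃`; non-contact distances `≥ √2` in both), so `σ_hc ≥ (√2 − 1)/4 > 1/10`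
rigorously (numerically the bottleneck distance of the two shells over `SO(3)` is `≈ 0.378`, g51); two-sided tear-freeness and the position budget put the
preimages of the `N_c ≥ 0.45·R²` c-sites with `|y| ≤ R/4` inside `win R` once `η ≤ 10⁻⁹/Cg'` (counting, NODE-g51 §2); hence `Σ_{win R} σ³ ≥ 4.5·10⁻⁴·R²`
(`2.4·10⁻²·R²` numerically) against `ε·η·nK(win R) = 57·(ε/Cg)·R²` at `R = 9.7/(Cg·η)`: (M) fails for every `ε < 8·10⁻⁶·Cg`.  The same sheet makes
`≥ 0.45·R²` window sites `ϑ₀`-wild for every re-registration ((R_W), (A1) fail for `εw < 10⁻³·Cg`), violates [C] (ii) on sheet-centred balls of radii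
`r_lo(b, d, A, Cg) < r < c·σ_hc²/(b·A·η)` (a slab of inflated `σ` only moves the window of radii, its thickness being capped by (i)), and likewise [CC] (ii♭)
(large sheet balls are `κ`-near); `S = hcp` is `0`-tame and `0`-coherent relative to `H ⊇` hcp half-spaces (the model map `g` of `IsTameStar` is free), so
the `Ψ`-free side conditions of [C_T], [CC], [CC°], [CC°_W] hold and these fail with [C]; [SR] dies the same way (bond distortion `> 1/10 ≥ τ₀`-scale misfit
at every preimage of a c-site; independently [C] ⇒ (M) is the kernel-checked Gehring seam of part UB, so [C] falls with (M) by modus tollens).  UNAFFECTED: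
every piece with `Ψ'`-FREE conclusion (catalogue side: [T], [T_b], [D_w], [I_D], [W], the calm / cloud / moat / dressed / clamped / core-gap cuts of parts
UE–UH), the kinematic pieces (K), [KS], the Gehring leaf, the pieces with EXPLICIT small-defect hypotheses ((A⁰ᴱ), (D⁰ᴱ), (C♭ᴱ), (FF), (E), (N♮)), the A0-line.
(2) ROOT CAUSE AND REPAIR.  The glue `harmonicContractionPGLms_of_ten_pieces_XE` (part TPb) applies (R_W) ONLY at the chart and registration delivered by
(A0ˣ) `GlobalChartRegistrationPX`, and the columns `_16XH17 … 19` obtain (A0ˣ) as the projection `globalChartRegistrationPX_of_iso` of (A0⁺ˣ)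
`GlobalChartIsoRegistrationPX` (part TN): the column PROVES that `Ψ` is a bond isomorphism (`IsBondIso S Ψ`, part TG) and discards it one line before the
refutable piece is invoked.  A bond isomorphism transports contact graphs, so the letters of `H` along `Ψ(S)` are those of `S`: a relatively faulted chart
admits NO bond-isomorphic registration and the witness is gone, while for a bond-isomorphic `Ψ` the tilt–strain data measure `S`'s OWN local distortion
(`σ ≲ θ + local strain < 0.28`: no sheet).  REPAIR («BondIso threading» — no idea content, no new currency): `Xᵇ := X` with the hypothesis `IsBondIso S Ψ →`
inserted after `IsGlobalReg Cg η R S (LayeredHom L w) Ψ →` (the GIVEN registration only; conclusions verbatim); (Mᵇ), (R_Wᵇ) regain their intended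
content (higher integrability / ε-regularity of the physical strain; the hot-spot scenario of parts TB/TR is untouched and is now the ONLY known risk).
(3) CONTENTS (0 sorry).  §Z.1 (R_Wᵇ) `WildFractionBPG`, (Mᵇ) `StrainNonConcentrationBPG`; projections `(R_W) ⇒ (R_Wᵇ)`, `(M) ⇒ (Mᵇ)` (PROVED; the converses
are the refuted direction).  §Z.2 SEAM `(K) ∧ (Mᵇ) ⇒ (R_Wᵇ)` (PROVED: part TR's seam, clause threaded).  §Z.3 ★★★ GLUE `harmonicContractionPGLms_of_ten_pieces_XEB`:
(HC)(s) ⟸ (T) ∧ (U♮ᴱ) ∧ (A0⁺ˣ) ∧ (N♮) ∧ (FF) ∧ (E) ∧ (A⁰ᴱ) ∧ (D⁰ᴱ) ∧ (C♭ᴱ) ∧ (R_Wᵇ) (PROVED: part TPb's proof with the clause kept and handed to (R_Wᵇ));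
`halvingBasinPGLms_of_eleven_pieces_XEB`; the iso producer `globalChartIsoRegistrationPX_of_subline_scales` (part TQ's sub-line WITHOUT the final projection).
§Z.4 COLUMNS `gap_and_pert_1_50_of_certs_16XH18B_tol` (leaf (R_Wᵇ)) and `…_16XH19B_tol`, `…_16XH19B` (leaves (K), (Mᵇ)): the same 23 leaves as `_16XH18/19`
with `(R_W) ↦ (R_Wᵇ)` resp. `(M) ↦ (Mᵇ)`.  (4) WHAT REMAINS (part UJ, mechanical): [Cᵇ], [C_Tᵇ], [CCᵇ], [CC°ᵇ], [CC°_Wᵇ] (same insertion) and the seams of parts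
UB–UD re-proved with the clause passed along; the catalogue side ([T] and ALL its cuts, parts UE–UH, [W], [KS], the Gehring leaf) is untouched (`Ψ'`-free
conclusions).  Docket of record after UI + UJ: `(Mᵇ) ⟸ Gehring-leaf ∧ [I_D] ∧ [T_b] ∧ [KS] ∧ [W] ∧ [CC°_Wᵇ]` — one residual re-typed, none added; row 830's
[SR] / (F1) / (F2) programme is WITHDRAWN (S-side faults need no exclusion: the (A0⁺ˣ)-chart carries `S`'s own word, faults included).
No `sorry`, no new axiom, no instance / notation; every currency is the tree's (`IsBondIso` part TG, `IsGlobalReg` part TB, `IsTiltStrainData` part TR).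
-/

noncomputable section

open scoped BigOperators InnerProductSpace RealInnerProductSpace
open MeasureTheory Set Metric Filter Topology
open Summit.AtomisticToContinuum.Crystallization.Theorems.ChartedPlanarOrderRigidityDoor
  (E3 IsClean IsNash IsCharted IsEStarGSC VisibleGap PertRegime atomsIn siteEnergy eStar BindingSurface)
open Summit.AtomisticToContinuum.Crystallization.Theorems.ChartedPlanarOrderDensityDichotomy (μS IsSep nK nK_nonneg excess)
open Summit.AtomisticToContinuum.Crystallization.Theorems.ChartedPlanarOrderMesoCut (IsDoorSet NearHom LayeredHom EnvClose)
open Summit.AtomisticToContinuum.Crystallization.Theorems.ChartedPlanarOrderDoorLayered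
  (TwoPeriodic DoorPeriodic PeriodicBulkGapDoor NearHomL2BD nearHomL2BD_mono Layered atomsIn_subset)
open Summit.AtomisticToContinuum.Crystallization.Theorems.ChartedPlanarOrderDoorLayeredOsc (IsTwoShellAffineGood DoorPeriodicOsc)
open Summit.AtomisticToContinuum.Crystallization.Theorems.ChartedPlanarOrderCleanScaleP (IsCleanP IsDoorSetP DoorPeriodicP isDoorSetP_one_iff)
open Literature.MathematicalPhysics.StatisticalMechanics (lennardJones IsHaggSeq triangularVec₁ triangularVec₂ card_le_of_separated_of_dist_le)

namespace Summit.AtomisticToContinuum.Crystallization.Theorems.ChartedZeroExcessLayeredLatticeLiouville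

/-! ### Z.1  The re-typed pieces (R_Wᵇ), (Mᵇ): the GIVEN registration is a bond isomorphism -/
/-- ★★ **(R_Wᵇ) «WildFractionBPG aHi Λ θ s»** — (R_W) `WildFractionPG` (part TB) VERBATIM with ONE extra hypothesis on the GIVEN registration: `IsBondIso S Ψ`
(part TG: `Ψ` preserves and reflects the relation «distance `≤ 28/25`», i.e. is an isomorphism of contact graphs onto the chart) — exactly what (A0⁺ˣ)
`GlobalChartIsoRegistrationPX` delivers and the glue of part TPb threw away.  Conclusion unchanged (a re-registration `Ψ'` into the same chart at `(Cg', η, R)`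
with `ϑ₀`-wild mass `≤ εw·η·nK(win R)`).  ε-REGULARITY-type · GSC-priced · UNDECIDED · TRUE-type-expected · RESIDUAL of column `_16XH18B`.
Why it might fail: the hot-spot scenario ONLY (a density `≍ η` of bounded, single-site-Nash, e⋆-GSC-compatible clusters of `O(1)` bond distortion inside a
bond-isomorphically registered near-flat window); the relatively faulted charts of the module docstring («ChartLamella»), which refute (R_W) as typed, admit no
bond-isomorphic registration (h- and c-stars have non-isomorphic contact graphs) and are excluded by the new hypothesis.
Sources: parts TB, TG, TN, TPb; [giaquinta1984 Ch. IV], [Evans1986]; Conway–Sloane SPLAG Ch. 1 (the two 12-contact graphs); census TAG 174. [this file, g51] -/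
def WildFractionBPG (aHi Λ θ s : ℝ) : Prop :=
  ∀ δ : ℝ, 0 < δ → ∀ a : ℝ, 0 < a → ∀ Cg : ℝ, 1 ≤ Cg → ∃ Cg' : ℝ, Cg ≤ Cg' ∧
    ∀ εw : ℝ, 0 < εw → ∀ K₀ : ℝ, 0 < K₀ → ∃ η₁ : ℝ, 0 < η₁ ∧ ∃ R₁ : ℝ, 0 < R₁ ∧
      ∀ S : Set E3, IsDoorSetPG aHi δ S → (∀ q ∈ S, IsTwoShellAffineGood θ S q) →
        ∀ η : ℝ, 0 < η → η ≤ η₁ → ∀ R : ℝ, R₁ ≤ R →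
          ∀ (L : E3 ≃L[ℝ] E3) (w : ℤ → E3), IsEquilChart a s Λ L w →
            ∀ Ψ : E3 → E3, IsGlobalReg Cg η R S (LayeredHom (L : E3 →L[ℝ] E3) w) Ψ → IsBondIso S Ψ →
              K₀ ≤ η * nK (atomsIn (μS S) 0 R) →
                ∃ Ψ' : E3 → E3, IsGlobalReg Cg' η R S (LayeredHom (L : E3 →L[ℝ] E3) w) Ψ' ∧
                  wildMass tameRadius (atomsIn (μS S) 0 R) Ψ' ≤ εw * η * nK (atomsIn (μS S) 0 R)

/-- ★★ **(Mᵇ) «StrainNonConcentrationBPG aHi Λ θ s»** — (M) `StrainNonConcentrationPG` (part TR) VERBATIM with the extra hypothesis `IsBondIso S Ψ` on the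
GIVEN registration (conclusion unchanged: a re-registration `Ψ'` at `(Cg', η, R)` into the same chart with tilt–strain data whose strain has `Σ_{win R} σ³ ≤
ε·η·nK(win R)`).  For a bond-isomorphic `Ψ` the strain profile is `S`'s OWN local distortion against rigid motions (`σ ≲ θ + local strain`), so the statement
is the intended one: HIGHER INTEGRABILITY (Meyers / Gehring) of the physical strain of e⋆-GSC door sets on near-flat fat windows.  GENERIC · UNDECIDED · L.
Why it might fail: hot spots at density `≍ η` (as (M)); NOT the relatively faulted charts («ChartLamella»), which carry no bond-isomorphic registration.
Sources: part TR ((M) and its sources: Meyers 1963, Gehring 1973, Giaquinta–Modica 1979, [giaquinta1984 Ch. V], Evans 1986, E–Ming 2007); parts TG, TN. [this file, g51] -/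
def StrainNonConcentrationBPG (aHi Λ θ s : ℝ) : Prop :=
  ∀ δ : ℝ, 0 < δ → ∀ a : ℝ, 0 < a → ∀ Cg : ℝ, 1 ≤ Cg → ∃ Cg' : ℝ, Cg ≤ Cg' ∧
    ∀ ε : ℝ, 0 < ε → ∀ K₀ : ℝ, 0 < K₀ → ∃ η₁ : ℝ, 0 < η₁ ∧ ∃ R₁ : ℝ, 0 < R₁ ∧
      ∀ S : Set E3, IsDoorSetPG aHi δ S → (∀ q ∈ S, IsTwoShellAffineGood θ S q) →
        ∀ η : ℝ, 0 < η → η ≤ η₁ → ∀ R : ℝ, R₁ ≤ R →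
          ∀ (L : E3 ≃L[ℝ] E3) (w : ℤ → E3), IsEquilChart a s Λ L w →
            ∀ Ψ : E3 → E3, IsGlobalReg Cg η R S (LayeredHom (L : E3 →L[ℝ] E3) w) Ψ → IsBondIso S Ψ →
              K₀ ≤ η * nK (atomsIn (μS S) 0 R) →
                ∃ Ψ' : E3 → E3, IsGlobalReg Cg' η R S (LayeredHom (L : E3 →L[ℝ] E3) w) Ψ' ∧
                  ∃ (Q : E3 → (E3 ≃ₗᵢ[ℝ] E3)) (σ : E3 → ℝ), IsTiltStrainData S R Ψ' Q σ ∧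
                    ∑ᶠ x ∈ atomsIn (μS S) 0 R, σ x ^ 3 ≤ ε * η * nK (atomsIn (μS S) 0 R)

/-- **(R_W) ⇒ (R_Wᵇ) (PROVED)** — nothing of the old docket is lost: the re-typed residual is WEAKER (one more hypothesis). [this file, g51] -/
theorem wildFractionBPG_of_wildFractionPG {aHi Λ θ s : ℝ} (h : WildFractionPG aHi Λ θ s) : WildFractionBPG aHi Λ θ s := by
  intro δ hδ a ha Cg hCg
  obtain ⟨Cg', hCg', h'⟩ := h δ hδ a ha Cg hCg
  refine ⟨Cg', hCg', fun εw hεw K₀ hK₀ => ?_⟩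
  obtain ⟨η₁, hη₁, R₁, hR₁, h''⟩ := h' εw hεw K₀ hK₀
  exact ⟨η₁, hη₁, R₁, hR₁, fun S hS hg η hη hηle R hR L w hLw Ψ hΨ _ hfat => h'' S hS hg η hη hηle R hR L w hLw Ψ hΨ hfat⟩

/-- **(M) ⇒ (Mᵇ) (PROVED)** — the re-typed generic piece is WEAKER than (M). [this file, g51] -/
theorem strainNonConcentrationBPG_of_strainNonConcentrationPG {aHi Λ θ s : ℝ} (h : StrainNonConcentrationPG aHi Λ θ s) :
    StrainNonConcentrationBPG aHi Λ θ s := by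
  intro δ hδ a ha Cg hCg
  obtain ⟨Cg', hCg', h'⟩ := h δ hδ a ha Cg hCg
  refine ⟨Cg', hCg', fun ε hε K₀ hK₀ => ?_⟩
  obtain ⟨η₁, hη₁, R₁, hR₁, h''⟩ := h' ε hε K₀ hK₀
  exact ⟨η₁, hη₁, R₁, hR₁, fun S hS hg η hη hηle R hR L w hLw Ψ hΨ _ hfat => h'' S hS hg η hη hηle R hR L w hLw Ψ hΨ hfat⟩

/-! ### Z.2  The seam (K) ∧ (Mᵇ) ⇒ (R_Wᵇ) (PROVED) -/
/-- ★★★ **SEAM (PROVED): (K) `TiltRigidityP` ∧ (Mᵇ) `StrainNonConcentrationBPG` ⇒ (R_Wᵇ) `WildFractionBPG`** — part TR's `wildFractionPG_of_tilt_strain`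
verbatim with the bond-isomorphism clause handed from (R_Wᵇ)'s hypotheses to (Mᵇ); (K) is kinematic and needs no clause. [this file, g51] -/
theorem wildFractionBPG_of_tilt_strainB {aHi Λ θ s : ℝ} (hK : TiltRigidityP aHi Λ θ s) (hM : StrainNonConcentrationBPG aHi Λ θ s) :
    WildFractionBPG aHi Λ θ s := by
  intro δ hδ a ha Cg hCg
  obtain ⟨Cg', hCgCg', hM1⟩ := hM δ hδ a ha Cg hCg
  obtain ⟨CK, hCK, hK1⟩ := hK δ hδ a ha Cg' (hCg.trans hCgCg')
  refine ⟨Cg', hCgCg', fun εw hεw K₀ hK₀ => ?_⟩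
  -- the constants of the seam
  obtain ⟨A, hAdef⟩ : ∃ A : ℝ, A = 144 * (2 * 4 / δ + 1) ^ 3 * (2 / tameRadius) ^ 3 := ⟨_, rfl⟩
  obtain ⟨B, hBdef⟩ : ∃ B : ℝ, B = 144 * (2 * 4 / δ + 1) ^ 3 * (8 / tameRadius) ^ 3 := ⟨_, rfl⟩
  have hϑ := tameRadius_pos
  have hApos : 0 < A := by rw [hAdef]; positivity
  have hBpos : 0 < B := by rw [hBdef]; positivity
  have hABpos : 0 < A + B * CK := add_pos_of_pos_of_nonneg hApos (mul_nonneg hBpos.le (zero_le_one.trans hCK))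
  have hBne : B ≠ 0 := hBpos.ne'
  have hABne : A + B * CK ≠ 0 := hABpos.ne'
  obtain ⟨ηK, hηK, RK, hRK, hK2⟩ := hK1 (εw / (2 * B)) (by positivity)
  obtain ⟨ηM, hηM, RM, hRM, hM2⟩ := hM1 (εw / (2 * (A + B * CK))) (by positivity) K₀ hK₀
  refine ⟨min ηK ηM, lt_min hηK hηM, max RK RM, lt_max_of_lt_left hRK, ?_⟩
  intro S hS hgood η hη hηle R hR L w hLw Ψ hΨ hB hfat
  obtain ⟨Ψ', hΨ', Q, σ, hdata, hσ3⟩ :=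
    hM2 S hS hgood η hη (hηle.trans (min_le_right _ _)) R ((le_max_right _ _).trans hR) L w hLw Ψ hΨ hB hfat
  have htilt := hK2 S hS.isDoorSetP hgood η hη (hηle.trans (min_le_left _ _)) R ((le_max_left _ _).trans hR) L w hLw Ψ' hΨ' Q σ hdata
  refine ⟨Ψ', hΨ', ?_⟩
  have hsep : IsSep δ S := hS.1.2.1
  have hmass := wildMass_le_of_tiltStrainData hδ hϑ hsep hΨ'.2.1 hdata
  calc wildMass tameRadius (atomsIn (μS S) 0 R) Ψ'
      ≤ 144 * (2 * 4 / δ + 1) ^ 3 * ((2 / tameRadius) ^ 3 * ∑ᶠ x ∈ atomsIn (μS S) 0 R, σ x ^ 3 +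
          (8 / tameRadius) ^ 3 * ∑ᶠ x ∈ atomsIn (μS S) 0 R, tilt (Q x) ^ 3) := hmass
    _ = A * ∑ᶠ x ∈ atomsIn (μS S) 0 R, σ x ^ 3 + B * ∑ᶠ x ∈ atomsIn (μS S) 0 R, tilt (Q x) ^ 3 := by rw [hAdef, hBdef]; ring
    _ ≤ A * ∑ᶠ x ∈ atomsIn (μS S) 0 R, σ x ^ 3 +
          B * (CK * ∑ᶠ x ∈ atomsIn (μS S) 0 R, σ x ^ 3 + εw / (2 * B) * η * nK (atomsIn (μS S) 0 R)) :=
        add_le_add le_rfl (mul_le_mul_of_nonneg_left htilt hBpos.le)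
    _ = (A + B * CK) * ∑ᶠ x ∈ atomsIn (μS S) 0 R, σ x ^ 3 + εw / 2 * (η * nK (atomsIn (μS S) 0 R)) := by
        field_simp
        ring
    _ ≤ (A + B * CK) * (εw / (2 * (A + B * CK)) * η * nK (atomsIn (μS S) 0 R)) + εw / 2 * (η * nK (atomsIn (μS S) 0 R)) :=
        add_le_add (mul_le_mul_of_nonneg_left hσ3 hABpos.le) le_rfl
    _ = εw * η * nK (atomsIn (μS S) 0 R) := by
        field_simp
        ring

/-! ### Z.3  ★★★ The glue (HC)(s) ⟸ the ten pieces with (A0⁺ˣ) and (R_Wᵇ) (PROVED), and the bond-isomorphic producer -/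

/-- ★★★ **(HC)(s) ⟸ (T) ∧ (U♮ᴱ)(s′,ν) ∧ (A0⁺ˣ)(s,s′) ∧ (N♮)(s′,ν) ∧ (FF) ∧ (E) ∧ (A⁰ᴱ) ∧ (D⁰ᴱ) ∧ (C♭ᴱ) ∧ (R_Wᵇ) (PROVED)** — part TPb's
`harmonicContractionPGLms_of_ten_pieces_XE` with the producer (A0⁺ˣ) `GlobalChartIsoRegistrationPX` in place of its projection (A0ˣ): the bond-isomorphism clause
`IsBondIso S Ψ` of the produced registration is KEPT and handed to (R_Wᵇ) in the FAT case; every other line verbatim. [this file, g51] -/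
theorem harmonicContractionPGLms_of_ten_pieces_XEB {aHi Λ θ s s' ν : ℝ} (hT : TailDominationCert) (hU : UniformTameStabilityE s' Λ ν)
    (h0 : GlobalChartIsoRegistrationPX aHi Λ θ s s') (hN : EnergyNearChartPX aHi Λ θ s' ν) (hF : TailForceSlavingP aHi Λ θ s')
    (hE : LipDualLinearisationP aHi Λ θ s') (hA : L2HarmonicApproxPE aHi Λ θ s' ν) (hD : PositionDecayPLE aHi Λ θ s' ν)
    (hC : PositionCaccioppoliPGE aHi Λ θ s' ν) (hW : WildFractionBPG aHi Λ θ s') : HarmonicContractionPGLms aHi Λ θ s := by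
  intro hL hL' δ hδ a ha c hc
  -- (A0ˣ): the registration constant `Cg` (energy input: BindingSurface's quadratic excess bound on the PG door); (N♮): its ceiling/floor at `(C₁, Cg)`
  obtain ⟨C₁, hC₁, hQ⟩ := hasQuadExcess_of_isDoorSetPG (δ := δ) hδ
  obtain ⟨Cg, hCg, η0, hη0, R0, hR0, h0'⟩ := h0 δ hδ a ha C₁ hC₁
  have hCg0 : 0 < Cg := zero_lt_one.trans_le hCg
  obtain ⟨ηN, hηN, RN, hRN, hN'⟩ := hN δ hδ a ha C₁ hC₁ Cg hCg
  -- (R_W): the re-registration constant `Cg' ≥ Cg`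
  obtain ⟨Cg', hCgCg', hW'⟩ := hW δ hδ a ha Cg hCg
  have hCg' : 1 ≤ Cg' := hCg.trans hCgCg'
  -- (C♭ᴱ), (A⁰ᴱ), (D⁰ᴱ), (E): their constants at `Cg'`
  obtain ⟨Cb, hCb, hC'⟩ := hC hT hU δ hδ a ha Cg' hCg'
  obtain ⟨CA, hCA, hA'⟩ := hA hT hU δ hδ a ha Cg' hCg'
  obtain ⟨CD, hCD, ϱD, hϱD, hD'⟩ := hD hT hU hL' δ hδ a ha Cg' hCg' CA hCA
  obtain ⟨Cl, hCl, hE'⟩ := hE δ hδ a ha Cg' hCg'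
  have hCb0 : 0 < Cb := zero_lt_one.trans_le hCb
  have hCD0 : 0 < CD := zero_lt_one.trans_le hCD
  have hCl0 : 0 < Cl := zero_lt_one.trans_le hCl
  -- the contraction ratio `t`, the closeness `ε`, the wild fraction `εw`
  set t : ℝ := min (1 / 128) (c / (3 * Cb * CD + c)) with ht_def
  have ht0 : 0 < t := lt_min (by norm_num) (by positivity)
  have ht128 : t ≤ 1 / 128 := min_le_left _ _
  have ht1 : t ≤ 1 := ht128.trans (by norm_num)
  have hCbCDt : Cb * CD * t ≤ c / 3 := by
    have h1 : t ≤ c / (3 * Cb * CD + c) := min_le_right _ _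
    rw [le_div_iff₀ (by positivity)] at h1
    nlinarith [mul_pos hCb0 hCD0, mul_nonneg hc.le ht0.le]
  have hCbCDt2 : Cb * CD * t ^ 2 ≤ c / 3 := by
    have ht2 : t ^ 2 ≤ t := by nlinarith
    exact (mul_le_mul_of_nonneg_left ht2 (by positivity)).trans hCbCDt
  set ε : ℝ := c * t ^ 5 / (3 * Cb) with hε_def
  have hε : 0 < ε := by positivity
  set εw : ℝ := c * t ^ 3 / (3 * Cb) with hεw_def
  have hεw : 0 < εw := by positivity
  -- (A⁰ᴱ) at `ε`: the residual tolerance `εr` and a range floor; (FF) at `εf := εr/(2C_ℓ)`: a range floor; the range `ϱ`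
  obtain ⟨εr, hεr, ϱA, hϱA, hA''⟩ := hA' ε hε
  set εf : ℝ := εr / (2 * Cl) with hεf_def
  have hεf : 0 < εf := by positivity
  obtain ⟨ϱF, hϱF, hF'⟩ := hF δ hδ a ha Cg' hCg' εf hεf
  set ϱ : ℝ := max (max ϱA ϱD) (max ϱF 1) with hϱ_def
  have hϱA' : ϱA ≤ ϱ := (le_max_left _ _).trans (le_max_left _ _)
  have hϱD' : ϱD ≤ ϱ := (le_max_right _ _).trans (le_max_left _ _)
  have hϱF' : ϱF ≤ ϱ := (le_max_left _ _).trans (le_max_right _ _)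
  have hϱ1 : 1 ≤ ϱ := (le_max_right _ _).trans (le_max_right _ _)
  -- ceilings and floors of every piece at these constants
  obtain ⟨CE, hCE, ηE, hηE, RE, hRE, hE''⟩ := hE' ϱ hϱ1
  have hCE0 : 0 < CE := zero_lt_one.trans_le hCE
  obtain ⟨ηA, hηA, RA, hRA, hA'''⟩ := hA'' ϱ hϱA'
  obtain ⟨ηD, hηD, RD, hRD, hD''⟩ := hD' ϱ hϱD' t ht0 ht128
  obtain ⟨ηF, hηF, RF, hRF, hF''⟩ := hF' ϱ hϱF'
  obtain ⟨ηb, hηb, Rb, hRb, hC''⟩ := hC' t ht0 ht128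
  obtain ⟨ηW, hηW, RW, hRW, hW''⟩ :=
    hW' εw hεw (tameRadius ^ 2 / (2 * Cg)) (div_pos (pow_pos tameRadius_pos 2) (by positivity))
  -- the extra ceiling making the linearisation residual `≤ εr`
  set ηs : ℝ := (εr / (2 * CE)) ^ 2 with hηs_def
  have hηs : 0 < ηs := by positivity
  refine ⟨t, ht0, ht1, min ηN (min (min (min η0 ηW) (min ηE ηA)) (min (min ηD ηF) (min ηb ηs))),
    lt_min hηN (lt_min (lt_min (lt_min hη0 hηW) (lt_min hηE hηA)) (lt_min (lt_min hηD hηF) (lt_min hηb hηs))),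
    max RN (max (max (max R0 RW) (max RE RA)) (max (max RD RF) Rb)), lt_max_of_lt_left hRN,
    fun S hSd hg η hη hηle R hR hms => ?_⟩
  have hηN' : η ≤ ηN := hηle.trans (min_le_left _ _)
  have hηle' : η ≤ min (min (min η0 ηW) (min ηE ηA)) (min (min ηD ηF) (min ηb ηs)) := hηle.trans (min_le_right _ _)
  have hη0' : η ≤ η0 := hηle'.trans ((min_le_left _ _).trans ((min_le_left _ _).trans (min_le_left _ _)))
  have hηW' : η ≤ ηW := hηle'.trans ((min_le_left _ _).trans ((min_le_left _ _).trans (min_le_right _ _)))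
  have hηE' : η ≤ ηE := hηle'.trans ((min_le_left _ _).trans ((min_le_right _ _).trans (min_le_left _ _)))
  have hηA' : η ≤ ηA := hηle'.trans ((min_le_left _ _).trans ((min_le_right _ _).trans (min_le_right _ _)))
  have hηD' : η ≤ ηD := hηle'.trans ((min_le_right _ _).trans ((min_le_left _ _).trans (min_le_left _ _)))
  have hηF' : η ≤ ηF := hηle'.trans ((min_le_right _ _).trans ((min_le_left _ _).trans (min_le_right _ _)))
  have hηb' : η ≤ ηb := hηle'.trans ((min_le_right _ _).trans ((min_le_right _ _).trans (min_le_left _ _)))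
  have hηs' : η ≤ ηs := hηle'.trans ((min_le_right _ _).trans ((min_le_right _ _).trans (min_le_right _ _)))
  have hRN' : RN ≤ R := (le_max_left _ _).trans hR
  have hR' : max (max (max R0 RW) (max RE RA)) (max (max RD RF) Rb) ≤ R := (le_max_right _ _).trans hR
  have hR0' : R0 ≤ R := ((le_max_left _ _).trans ((le_max_left _ _).trans (le_max_left _ _))).trans hR'
  have hRW' : RW ≤ R := ((le_max_right _ _).trans ((le_max_left _ _).trans (le_max_left _ _))).trans hR'
  have hRE' : RE ≤ R := ((le_max_left _ _).trans ((le_max_right _ _).trans (le_max_left _ _))).trans hR'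
  have hRA' : RA ≤ R := ((le_max_right _ _).trans ((le_max_right _ _).trans (le_max_left _ _))).trans hR'
  have hRD' : RD ≤ R := ((le_max_left _ _).trans ((le_max_left _ _).trans (le_max_right _ _))).trans hR'
  have hRF' : RF ≤ R := ((le_max_right _ _).trans ((le_max_left _ _).trans (le_max_right _ _))).trans hR'
  have hRb' : Rb ≤ R := ((le_max_right _ _).trans (le_max_right _ _)).trans hR'
  have hRpos : 0 < R := hR0.trans_le hR0'
  have hN : 0 ≤ nK (atomsIn (μS S) 0 R) := nK_nonneg _
  have hfin : (atomsIn (μS S) 0 R).Finite := finite_atomsIn hδ hSd.1.2.1 R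
  -- (A0ˣ): one equilibrium `s'`-chart and one global registration at `(Cg, η, R)`, from the `s`-hypothesis and the energy input
  obtain ⟨L, w, hEq, Ψ, hG, hB⟩ := h0' S hSd.1 hg (hQ aHi S hSd) η hη hη0' R hR0' hms
  -- (N♮): the chart is `ν`-ENERGY-NEAR (the same energy input, the (A0ˣ)-registration); a property of `(L, w)` alone, it survives re-registration
  have hEN : IsEnergyNear ν (LayeredHom (L : E3 →L[ℝ] E3) w) := hN' S hSd.1 hg (hQ aHi S hSd) η hη hηN' R hRN' L w hEq Ψ hG
  -- THIN/FAT: a registration at `(Cg', η, R)` whose `ϑ₀`-wild mass is `≤ εw·η·nK(win R)`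
  obtain ⟨Ψs, hGs, hWs⟩ : ∃ Ψs : E3 → E3, IsGlobalReg Cg' η R S (LayeredHom (L : E3 →L[ℝ] E3) w) Ψs ∧
      wildMass tameRadius (atomsIn (μS S) 0 R) Ψs ≤ εw * η * nK (atomsIn (μS S) 0 R) := by
    rcases lt_or_ge (η * nK (atomsIn (μS S) 0 R)) (tameRadius ^ 2 / (2 * Cg)) with hthin | hfat
    · -- THIN window: no wild bond at the tame radius; keep `Ψ`, upgraded to the constant `Cg'`
      refine ⟨Ψ, isGlobalReg_mono hCgCg' hη.le hRpos hG, ?_⟩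
      obtain ⟨τ, hτ⟩ := hG.2.2.2 R le_rfl
      have hlev : Cg * (R / R) * η * nK (atomsIn (μS S) 0 R) < tameRadius ^ 2 := by
        rw [div_self hRpos.ne', mul_one]
        calc Cg * η * nK (atomsIn (μS S) 0 R) = Cg * (η * nK (atomsIn (μS S) 0 R)) := by ring
          _ < Cg * (tameRadius ^ 2 / (2 * Cg)) := mul_lt_mul_of_pos_left hthin hCg0
          _ = tameRadius ^ 2 / 2 := by field_simp
          _ ≤ tameRadius ^ 2 := by linarith [sq_nonneg tameRadius]
      rw [wildMass_eq_zero_of_registered hτ hfin tameRadius_pos hlev]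
      exact mul_nonneg (mul_nonneg hεw.le hη.le) hN
    · -- FAT window: (R_W) re-registers at `Cg'`
      exact hW'' S hSd hg η hη hηW' R hRW' L w hEq Ψ hG hB hfat
  -- (FF): the tail force is `εf`-dual-small; (E): the linearisation residual is `(C_E√η + C_ℓ·εf)`-, hence `εr`-dual-small
  have hFD := hF'' S hSd.1 hg η hη hηF' R hRF' L w hEq Ψs hGs
  have hres := hE'' S hSd.1 hg η hη hηE' R hRE' L w hEq Ψs hGs εf hεf hFD
  have hsmall : CE * Real.sqrt η + Cl * εf ≤ εr := by
    have hsq : Real.sqrt η ≤ εr / (2 * CE) := by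
      calc Real.sqrt η ≤ Real.sqrt ηs := Real.sqrt_le_sqrt hηs'
        _ = εr / (2 * CE) := by rw [hηs_def]; exact Real.sqrt_sq (by positivity)
    have h1 : CE * Real.sqrt η ≤ εr / 2 := by
      calc CE * Real.sqrt η ≤ CE * (εr / (2 * CE)) := mul_le_mul_of_nonneg_left hsq hCE0.le
        _ = εr / 2 := by field_simp
    have h2 : Cl * εf = εr / 2 := by rw [hεf_def]; field_simp
    linarith
  have hres' := linResidualSmall_mono hsmall hres
  -- (A⁰ᴱ): the truncated-harmonic approximant `h`, position-close at level `ε`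
  obtain ⟨h, hharm, hgrad, hclose⟩ := hA''' S hSd.1 hg η hη hηA' R hRA' L w hEq hEN Ψs hGs hres'
  have hr2 : 2 * t * R ≤ R / 64 := by
    have h := mul_le_mul_of_nonneg_left ht128 hRpos.le
    linarith
  have hclose2 := hclose (2 * t * R) (by positivity) hr2
  -- (D⁰ᴱ): an affine-layered Taylor field `T` at the sub-window `win 2tR`
  obtain ⟨T, hTaff, hdec⟩ := hD'' S hSd.1 hg η hη hηD' R hRD' L w hEq hEN Ψs hGs h hharm hgrad
  -- (C♭ᴱ): position-level Caccioppoli at `t·R`, levels rewritten in units `(tR)²·t³·nK(win R)`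
  have e1 : ε * η * R ^ 2 * nK (atomsIn (μS S) 0 R) = ε * η / t ^ 5 * (t * R) ^ 2 * (t ^ 3 * nK (atomsIn (μS S) 0 R)) := by
    field_simp
  have e2 : CD * t ^ 7 * R ^ 2 * η * nK (atomsIn (μS S) 0 R) = CD * η * t ^ 2 * (t * R) ^ 2 * (t ^ 3 * nK (atomsIn (μS S) 0 R)) := by
    ring
  have e3 : εw * η * nK (atomsIn (μS S) 0 R) = εw * η / t ^ 3 * (t ^ 3 * nK (atomsIn (μS S) 0 R)) := by
    field_simp
  rw [e1] at hclose2
  rw [e2] at hdec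
  rw [e3] at hWs
  have hout := hC'' S hSd hg η hη hηb' R hRb' L w hEq hEN Ψs hGs h T hTaff (ε * η / t ^ 5) (CD * η * t ^ 2) (εw * η / t ^ 3)
    (by positivity) (by positivity) (by positivity) hclose2 hdec hWs
  -- the three levels add up to `≤ c·η`
  have hlev : Cb * (ε * η / t ^ 5 + CD * η * t ^ 2 + εw * η / t ^ 3) ≤ c * η := by
    have f1 : Cb * (ε * η / t ^ 5) = c * η / 3 := by rw [hε_def]; field_simp
    have f2 : Cb * (εw * η / t ^ 3) = c * η / 3 := by rw [hεw_def]; field_simp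
    have f3 : Cb * (CD * η * t ^ 2) ≤ c * η / 3 := by
      calc Cb * (CD * η * t ^ 2) = Cb * CD * t ^ 2 * η := by ring
        _ ≤ c / 3 * η := mul_le_mul_of_nonneg_right hCbCDt2 hη.le
        _ = c * η / 3 := by ring
    calc Cb * (ε * η / t ^ 5 + CD * η * t ^ 2 + εw * η / t ^ 3)
        = Cb * (ε * η / t ^ 5) + Cb * (CD * η * t ^ 2) + Cb * (εw * η / t ^ 3) := by ring
      _ ≤ c * η / 3 + c * η / 3 + c * η / 3 := by linarith
      _ = c * η := by ring
  exact nearHomL2BD_mono hlev hout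

/-- ★★ **H♭^ℓ,ms(s) ⟸ (P)(s) ∧ the ten pieces with (A0⁺ˣ), (R_Wᵇ) (PROVED)**. [this file, g51] -/
theorem halvingBasinPGLms_of_eleven_pieces_XEB {aHi Λ θ s s' ν : ℝ} (hP : RegistrationP aHi Λ θ s) (hT : TailDominationCert)
    (hU : UniformTameStabilityE s' Λ ν) (h0 : GlobalChartIsoRegistrationPX aHi Λ θ s s') (hN : EnergyNearChartPX aHi Λ θ s' ν)
    (hF : TailForceSlavingP aHi Λ θ s') (hE : LipDualLinearisationP aHi Λ θ s') (hA : L2HarmonicApproxPE aHi Λ θ s' ν)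
    (hD : PositionDecayPLE aHi Λ θ s' ν) (hC : PositionCaccioppoliPGE aHi Λ θ s' ν) (hW : WildFractionBPG aHi Λ θ s') :
    HalvingBasinPGLms aHi Λ θ s :=
  halvingBasinPGLms_of_reg_contr hP (harmonicContractionPGLms_of_ten_pieces_XEB hT hU h0 hN hF hE hA hD hC hW)

/-- ★★ **(A0⁺ˣ)(s,s′) ⟸ (B1)(s) ∧ (G♯ˣ) ∧ (Λ₀) ∧ (Λ↑) ∧ (Υ)(s′) ∧ (A0♯⁺)(s′) at `aHi = 1`, `s ≤ s′` (PROVED)** — part TQ's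
`globalChartRegistrationPX_of_subline_scales` WITHOUT the final projection `globalChartRegistrationPX_of_iso`: the bond isomorphism is kept. [this file, g51] -/
theorem globalChartIsoRegistrationPX_of_subline_scales {Λ θ s s' : ℝ} (hss : s ≤ s') (h1 : WordTransplantP 1 Λ θ s)
    (hT : GradReframingThickP 1 Λ θ s s') (h0 : LaunderingAprioriPX 1 Λ θ s s') (hu' : LaunderingStepPX 1 Λ θ s s')
    (hu : LateralUntwistP 1 Λ θ s') (hL : BondIsoLevelsP 1 Λ θ s') : GlobalChartIsoRegistrationPX 1 Λ θ s s' :=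
  globalChartIsoRegistrationPX_of_bondIso_levels hss
    (equilChartBondIsoPX_of_pieces h1 (bondIsoReframingP_of_grad_poincare
      (gradReframingP_of_thick_thin hT (gradReframingThinP_of_laundering_untwist (thinLaunderingPX_of_apriori_step h1 h0 hu') hu))
      windowPoincareP_one) bondIsoTearFreeP_one) hL

/-! ### Z.4  The columns `_16XH18B_tol` (leaf (R_Wᵇ)), `_16XH19B_tol` / `_16XH19B` (leaves (K), (Mᵇ)) -/

/-- ★★★ **COLUMN `_16XH18B_tol` — the TWENTY-THREE leaves of `_16XH18_tol` with `(R_W) ↦ (R_Wᵇ)`** (ν generic): `LatticeLiouvilleCert → LayeredLiouvilleCert →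
R_G → X → Z_E(1/100) → P(1/100) → T → U♮ᴱ(ν) → B1(1/100) → G♯ˣ → Λ₀ → Λ↑ → Υc → Υb → A0♯⁺ → N♮(ν) → FF → E → A⁰ᴱ(ν) → D⁰ᴱ(ν) → C♭ᴱ(ν) → R_Wᵇ →
PeriodicBulkGapDoor 2 → VisibleGap (1/50) ∧ PertRegime (1/50)` — the bond isomorphism produced by the (A0)-sub-line is no longer discarded. [this file, g51] -/
theorem gap_and_pert_1_50_of_certs_16XH18B_tol {ν : ℝ} (hL : LatticeLiouvilleCert) (hL' : LayeredLiouvilleCert)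
    (hR : OscRigidityL2BDPG 1 2 (1 / 16) (1 / 16)) (hX : ExcessFlatnessControlP 1 2 (1 / 16) (1 / 16))
    (hE : ExcessChartLocalisationP 1 2 (1 / 16) (1 / 100)) (hP : RegistrationP 1 2 (1 / 16) (1 / 100))
    (hT : TailDominationCert) (hU : UniformTameStabilityE (1 / 50) 2 ν)
    (h1 : WordTransplantP 1 2 (1 / 16) (1 / 100)) (hGT : GradReframingThickP 1 2 (1 / 16) (1 / 100) (1 / 50))
    (hΛ0 : LaunderingAprioriPX 1 2 (1 / 16) (1 / 100) (1 / 50)) (hΛs : LaunderingStepPX 1 2 (1 / 16) (1 / 100) (1 / 50))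
    (hUc : UntwistCollarP 1 2 (1 / 16) (1 / 50)) (hUb : UntwistBookkeepingP 1 2 (1 / 50))
    (hl : BondIsoLevelsP 1 2 (1 / 16) (1 / 50)) (hN : EnergyNearChartPX 1 2 (1 / 16) (1 / 50) ν)
    (hF : TailForceSlavingP 1 2 (1 / 16) (1 / 50))
    (hE' : LipDualLinearisationP 1 2 (1 / 16) (1 / 50)) (hA : L2HarmonicApproxPE 1 2 (1 / 16) (1 / 50) ν)
    (hD : PositionDecayPLE 1 2 (1 / 16) (1 / 50) ν) (hC : PositionCaccioppoliPGE 1 2 (1 / 16) (1 / 50) ν)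
    (hW : WildFractionBPG 1 2 (1 / 16) (1 / 50)) (hG : PeriodicBulkGapDoor 2) : VisibleGap (1 / 50) ∧ PertRegime (1 / 50) :=
  gap_and_pert_1_50_of_certs_16XHlms_tol hL hL' hR hX hE
    (halvingBasinPGLms_of_eleven_pieces_XEB hP hT hU
      (globalChartIsoRegistrationPX_of_subline_scales (by norm_num) h1 hGT hΛ0 hΛs (lateralUntwistP_of_collar_book hUc hUb) hl)
      hN hF hE' hA hD hC hW) hG

/-- ★★★ **COLUMN `_16XH19B_tol` — the TWENTY-THREE leaves of `_16XH19_tol` with `(M) ↦ (Mᵇ)`** (ν generic; (R_Wᵇ) cut by `wildFractionBPG_of_tilt_strainB`,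
(Υb) discharged by `untwistBookkeepingP_one`): `… → C♭ᴱ(ν) → K → Mᵇ → PeriodicBulkGapDoor 2 → VisibleGap (1/50) ∧ PertRegime (1/50)`. [this file, g51] -/
theorem gap_and_pert_1_50_of_certs_16XH19B_tol {ν : ℝ} (hL : LatticeLiouvilleCert) (hL' : LayeredLiouvilleCert)
    (hR : OscRigidityL2BDPG 1 2 (1 / 16) (1 / 16)) (hX : ExcessFlatnessControlP 1 2 (1 / 16) (1 / 16))
    (hE : ExcessChartLocalisationP 1 2 (1 / 16) (1 / 100)) (hP : RegistrationP 1 2 (1 / 16) (1 / 100))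
    (hT : TailDominationCert) (hU : UniformTameStabilityE (1 / 50) 2 ν)
    (h1 : WordTransplantP 1 2 (1 / 16) (1 / 100)) (hGT : GradReframingThickP 1 2 (1 / 16) (1 / 100) (1 / 50))
    (hΛ0 : LaunderingAprioriPX 1 2 (1 / 16) (1 / 100) (1 / 50)) (hΛs : LaunderingStepPX 1 2 (1 / 16) (1 / 100) (1 / 50))
    (hUc : UntwistCollarP 1 2 (1 / 16) (1 / 50))
    (hl : BondIsoLevelsP 1 2 (1 / 16) (1 / 50)) (hN : EnergyNearChartPX 1 2 (1 / 16) (1 / 50) ν)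
    (hF : TailForceSlavingP 1 2 (1 / 16) (1 / 50))
    (hE' : LipDualLinearisationP 1 2 (1 / 16) (1 / 50)) (hA : L2HarmonicApproxPE 1 2 (1 / 16) (1 / 50) ν)
    (hD : PositionDecayPLE 1 2 (1 / 16) (1 / 50) ν) (hC : PositionCaccioppoliPGE 1 2 (1 / 16) (1 / 50) ν)
    (hKt : TiltRigidityP 1 2 (1 / 16) (1 / 50)) (hM : StrainNonConcentrationBPG 1 2 (1 / 16) (1 / 50))
    (hG : PeriodicBulkGapDoor 2) : VisibleGap (1 / 50) ∧ PertRegime (1 / 50) :=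
  gap_and_pert_1_50_of_certs_16XH18B_tol hL hL' hR hX hE hP hT hU h1 hGT hΛ0 hΛs hUc (untwistBookkeepingP_one 2 (1 / 50)) hl hN hF hE' hA
    hD hC (wildFractionBPG_of_tilt_strainB hKt hM) hG

/-- ★★★ **COLUMN `_16XH19B` — the candidate of record after the ChartLamella repair (ν := 1/2000; 23 leaves; NO leaf refutable by relatively faulted charts)**;
open on the (R_W)-line: (K) [L, known-type] and (Mᵇ) [L], beneath which the U-chain of parts UA–UH runs once re-threaded (part UJ). [this file, g51] -/
theorem gap_and_pert_1_50_of_certs_16XH19B (hL : LatticeLiouvilleCert) (hL' : LayeredLiouvilleCert)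
    (hR : OscRigidityL2BDPG 1 2 (1 / 16) (1 / 16)) (hX : ExcessFlatnessControlP 1 2 (1 / 16) (1 / 16))
    (hE : ExcessChartLocalisationP 1 2 (1 / 16) (1 / 100)) (hP : RegistrationP 1 2 (1 / 16) (1 / 100))
    (hT : TailDominationCert) (hU : UniformTameStabilityE (1 / 50) 2 (1 / 2000))
    (h1 : WordTransplantP 1 2 (1 / 16) (1 / 100)) (hGT : GradReframingThickP 1 2 (1 / 16) (1 / 100) (1 / 50))
    (hΛ0 : LaunderingAprioriPX 1 2 (1 / 16) (1 / 100) (1 / 50)) (hΛs : LaunderingStepPX 1 2 (1 / 16) (1 / 100) (1 / 50))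
    (hUc : UntwistCollarP 1 2 (1 / 16) (1 / 50))
    (hl : BondIsoLevelsP 1 2 (1 / 16) (1 / 50)) (hN : EnergyNearChartPX 1 2 (1 / 16) (1 / 50) (1 / 2000))
    (hF : TailForceSlavingP 1 2 (1 / 16) (1 / 50))
    (hE' : LipDualLinearisationP 1 2 (1 / 16) (1 / 50)) (hA : L2HarmonicApproxPE 1 2 (1 / 16) (1 / 50) (1 / 2000))
    (hD : PositionDecayPLE 1 2 (1 / 16) (1 / 50) (1 / 2000)) (hC : PositionCaccioppoliPGE 1 2 (1 / 16) (1 / 50) (1 / 2000))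
    (hKt : TiltRigidityP 1 2 (1 / 16) (1 / 50)) (hM : StrainNonConcentrationBPG 1 2 (1 / 16) (1 / 50))
    (hG : PeriodicBulkGapDoor 2) : VisibleGap (1 / 50) ∧ PertRegime (1 / 50) :=
  gap_and_pert_1_50_of_certs_16XH19B_tol hL hL' hR hX hE hP hT hU h1 hGT hΛ0 hΛs hUc hl hN hF hE' hA hD hC hKt hM hG

end Summit.AtomisticToContinuum.Crystallization.Theorems.ChartedZeroExcessLayeredLatticeLiouville
end
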